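import Mathlib.Analysis.SpecialFunctions.SmoothTransition
import Mathlib.Analysis.Calculus.Deriv.Comp
import Mathlib.Analysis.Calculus.Deriv.Mul
import Mathlib.Analysis.Calculus.IteratedDeriv.Lemmas
import Mathlib.Topology.Algebra.Order.Floor
import Mathlib.Analysis.SpecificLimits.Basic
import HarnessLib

/-!
# Time gluing for quasi-self-similar constructions: gluing times, block index, flat steps

The anomalous-dissipation constructions of Bruè–De Lellis (Comm. Math. Phys. 400 (2023), §5,
(5.1)–(5.4)) and Cheskidov (arXiv:2311.04182, §3, (3.2)–(3.5)) glue a sequence of building blocks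
`(ρ_n, v_n)` living on the unit time interval into one evolution on `[0,1)`: block `n` is played
on `[t_n, t_{n+1})` through a smooth nondecreasing reparametrisation which is *flat* at the
gluing times, so that the glued fields are smooth although consecutive blocks only match to
order zero. This file provides that elementary real-variable bookkeeping, in the variant used by
the Literature proof of `Cheskidov2023_thm21_noDissipationAnomaly` (reparametrisation locally
*constant* near the gluing times, which makes all local smoothness statements trivial):

* `Gluing.step` — a smooth step `ℝ → [0,1]`, `= 0` on `(-∞, 1/3]`, `= 1` on `[2/3, ∞)`
  (Mathlib's `Real.smoothTransition` rescaled), with vanishing derivatives off `(1/3, 2/3)` and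
  bounded derivatives of all orders;
* `Gluing.tn n = 1 - 1/(n+1)` (gluing times, `t₀ = 0`, `tₙ ↑ 1`) and
  `Gluing.tau n = tₙ₊₁ - tₙ = 1/((n+1)(n+2))` (the paper uses `tₙ = 1 - (n+1)⁻²`; any choice with
  polynomially decaying block lengths works);
* `Gluing.blockIdx t` — the index of the block `[tₙ, tₙ₊₁) ∋ t`, with
  `Gluing.mem_Ico_tn_blockIdx`, `Gluing.blockIdx_of_mem_Ico` and `Gluing.tendsto_blockIdx`
  (`blockIdx t → ∞` as `t → 1⁻`);
* `Gluing.sigma n t = step ((t - tₙ)/τₙ)` — the reparametrisation of block `n`, `= 0` on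
  `[tₙ, tₙ + τₙ/3]`, `= 1` on `[tₙ + 2τₙ/3, ∞)`, with `|σₙ'| ≤ B/τₙ`, `|σₙ''| ≤ B/τₙ²`.

## References

* E. Bruè, C. De Lellis, Comm. Math. Phys. 400 (2023), §5, (5.1)–(5.4) (the gluing function `η`).
* A. Cheskidov, arXiv:2311.04182 (2023), §3, (3.2)–(3.5).
-/

open Set Filter Topology

noncomputable section

namespace Literature.Analysis.FluidPDE.Gluing

/-! ## A smooth step, flat on `(-∞, 1/3]` and on `[2/3, ∞)` -/

/-- A smooth nondecreasing step `ℝ → [0,1]` vanishing for `x ≤ 1/3` and equal to `1` for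
`x ≥ 2/3` (Mathlib's `Real.smoothTransition` rescaled). [folklore] -/
def step (x : ℝ) : ℝ := Real.smoothTransition (3 * x - 1)

/-- The step is smooth. [folklore] -/
theorem step_contDiff {n : ℕ∞} : ContDiff ℝ n step :=
  Real.smoothTransition.contDiff.comp ((contDiff_const.mul contDiff_id).sub contDiff_const)

/-- The step vanishes on `(-∞, 1/3]`. [folklore] -/
theorem step_of_le {x : ℝ} (hx : x ≤ 1 / 3) : step x = 0 :=
  Real.smoothTransition.zero_of_nonpos (by linarith)

/-- The step equals `1` on `[2/3, ∞)`. [folklore] -/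
theorem step_of_ge {x : ℝ} (hx : 2 / 3 ≤ x) : step x = 1 :=
  Real.smoothTransition.one_of_one_le (by linarith)

/-- The step is nonnegative. [folklore] -/
theorem step_nonneg (x : ℝ) : 0 ≤ step x := Real.smoothTransition.nonneg _

/-- The step is at most `1`. [folklore] -/
theorem step_le_one (x : ℝ) : step x ≤ 1 := Real.smoothTransition.le_one _

/-- The step takes values in `[0,1]`. [folklore] -/
theorem step_mem_Icc (x : ℝ) : step x ∈ Icc (0 : ℝ) 1 := ⟨step_nonneg x, step_le_one x⟩

/-- The step is locally constant off `(1/3, 2/3)`, so its derivative vanishes there. [folklore] -/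
theorem deriv_step_of_lt {x : ℝ} (hx : x < 1 / 3) : deriv step x = 0 := by
  have h : step =ᶠ[𝓝 x] fun _ => (0 : ℝ) := by
    filter_upwards [Iio_mem_nhds hx] with y hy using step_of_le hy.le
  rw [h.deriv_eq, deriv_const]

/-- The derivative of the step vanishes on `(2/3, ∞)`. [folklore] -/
theorem deriv_step_of_gt {x : ℝ} (hx : 2 / 3 < x) : deriv step x = 0 := by
  have h : step =ᶠ[𝓝 x] fun _ => (1 : ℝ) := by
    filter_upwards [Ioi_mem_nhds hx] with y hy using step_of_ge hy.le
  rw [h.deriv_eq, deriv_const]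

/-- All derivatives of positive order of the step vanish on `(-∞, 1/3)`. [folklore] -/
theorem iteratedDeriv_step_of_lt {x : ℝ} (hx : x < 1 / 3) {k : ℕ} (hk : k ≠ 0) :
    iteratedDeriv k step x = 0 := by
  have h : step =ᶠ[𝓝 x] fun _ => (0 : ℝ) := by
    filter_upwards [Iio_mem_nhds hx] with y hy using step_of_le hy.le
  rw [h.iteratedDeriv_eq, iteratedDeriv_const]
  simp [hk]

/-- All derivatives of positive order of the step vanish on `(2/3, ∞)`. [folklore] -/
theorem iteratedDeriv_step_of_gt {x : ℝ} (hx : 2 / 3 < x) {k : ℕ} (hk : k ≠ 0) :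
    iteratedDeriv k step x = 0 := by
  have h : step =ᶠ[𝓝 x] fun _ => (1 : ℝ) := by
    filter_upwards [Ioi_mem_nhds hx] with y hy using step_of_ge hy.le
  rw [h.iteratedDeriv_eq, iteratedDeriv_const]
  simp [hk]

/-- All derivatives of the step are bounded (continuous, and zero off `[0,1]`). [folklore] -/
theorem exists_forall_abs_iteratedDeriv_step_le (k : ℕ) : ∃ B : ℝ, ∀ x, |iteratedDeriv k step x| ≤ B := by
  have hc : Continuous (iteratedDeriv k step) := step_contDiff.continuous_iteratedDeriv k (by
    exact_mod_cast le_top)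
  obtain ⟨B, hB⟩ := isCompact_Icc.exists_bound_of_continuousOn (s := Icc (0 : ℝ) 1) hc.continuousOn
  refine ⟨max B 1, fun x => ?_⟩
  by_cases hx : x ∈ Icc (0 : ℝ) 1
  · exact (hB x hx).trans (le_max_left _ _)
  · rcases k with _ | k
    · simp only [iteratedDeriv_zero]
      rw [abs_le]
      exact ⟨by linarith [step_nonneg x, le_max_right B 1], (step_le_one x).trans (le_max_right _ _)⟩
    · rw [mem_Icc, not_and_or, not_le, not_le] at hx
      rcases hx with hx | hx
      · rw [iteratedDeriv_step_of_lt (by linarith) (Nat.succ_ne_zero k), abs_zero]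
        exact le_trans zero_le_one (le_max_right _ _)
      · rw [iteratedDeriv_step_of_gt (by linarith) (Nat.succ_ne_zero k), abs_zero]
        exact le_trans zero_le_one (le_max_right _ _)

/-! ## The gluing times `tₙ = 1 - 1/(n+1)` and the block lengths `τₙ = tₙ₊₁ - tₙ` -/

/-- The gluing times `tₙ = 1 - 1/(n+1)`: `t₀ = 0`, `tₙ ↑ 1`. [folklore] -/
def tn (n : ℕ) : ℝ := 1 - 1 / (n + 1)

/-- The block lengths `τₙ = tₙ₊₁ - tₙ = 1/((n+1)(n+2))`. [folklore] -/
def tau (n : ℕ) : ℝ := 1 / ((n + 1) * (n + 2))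

/-- `t₀ = 0`. [folklore] -/
theorem tn_zero : tn 0 = 0 := by simp [tn]

/-- Block lengths are positive. [folklore] -/
theorem tau_pos (n : ℕ) : 0 < tau n := by unfold tau; positivity

/-- Block lengths are at most `1`. [folklore] -/
theorem tau_le_one (n : ℕ) : tau n ≤ 1 := by
  unfold tau
  rw [div_le_one (by positivity)]
  nlinarith [n.cast_nonneg (α := ℝ)]

/-- `tₙ₊₁ - tₙ = τₙ`. [folklore] -/
theorem tn_succ_sub (n : ℕ) : tn (n + 1) - tn n = tau n := by
  unfold tn tau
  push_cast
  field_simp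
  ring

/-- `tₙ₊₁ = tₙ + τₙ`. [folklore] -/
theorem tn_succ (n : ℕ) : tn (n + 1) = tn n + tau n := by linarith [tn_succ_sub n]

/-- `tₙ < 1`. [folklore] -/
theorem tn_lt_one (n : ℕ) : tn n < 1 := by
  unfold tn
  have : (0 : ℝ) < 1 / (n + 1) := by positivity
  linarith

/-- `0 ≤ tₙ`. [folklore] -/
theorem tn_nonneg (n : ℕ) : 0 ≤ tn n := by
  unfold tn
  rw [sub_nonneg, div_le_one (by positivity)]
  linarith [n.cast_nonneg (α := ℝ)]

/-- `tₙ < tₙ₊₁`. [folklore] -/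
theorem tn_lt_tn_succ (n : ℕ) : tn n < tn (n + 1) := by linarith [tn_succ_sub n, tau_pos n]

/-- The gluing times increase strictly. [folklore] -/
theorem tn_strictMono : StrictMono tn := strictMono_nat_of_lt_succ tn_lt_tn_succ

/-- The gluing times increase. [folklore] -/
theorem tn_mono : Monotone tn := tn_strictMono.monotone

/-- `1 - tₙ = 1/(n+1)`. [folklore] -/
theorem one_sub_tn (n : ℕ) : 1 - tn n = 1 / (n + 1) := by unfold tn; ring

/-- `tₙ → 1`. [folklore] -/
theorem tendsto_tn : Tendsto tn atTop (𝓝 1) := by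
  have h : Tendsto (fun n : ℕ => 1 - (1 : ℝ) / ((n : ℝ) + 1)) atTop (𝓝 (1 - 0)) :=
    tendsto_const_nhds.sub tendsto_one_div_add_atTop_nhds_zero_nat
  rw [sub_zero] at h
  exact h

/-! ## The block index of a time `t < 1` -/

/-- The index `n` of the block `[tₙ, tₙ₊₁)` containing `t` (junk for `t ≥ 1`). [folklore] -/
def blockIdx (t : ℝ) : ℕ := Nat.floor (1 / (1 - t)) - 1

/-- `tₙ ≤ t ↔ n + 1 ≤ 1/(1-t)` for `t < 1`. [folklore] -/
theorem tn_le_iff {t : ℝ} (ht : t < 1) (n : ℕ) : tn n ≤ t ↔ (n : ℝ) + 1 ≤ 1 / (1 - t) := by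
  have h1t : 0 < 1 - t := by linarith
  have hn : (0 : ℝ) < n + 1 := by positivity
  rw [le_div_iff₀ h1t, tn, sub_le_comm, le_div_iff₀ hn, mul_comm]

/-- `t < tₙ₊₁ ↔ 1/(1-t) < n + 2` for `t < 1`. [folklore] -/
theorem lt_tn_succ_iff {t : ℝ} (ht : t < 1) (n : ℕ) : t < tn (n + 1) ↔ 1 / (1 - t) < (n : ℝ) + 2 := by
  have h1t : 0 < 1 - t := by linarith
  have hn : (0 : ℝ) < n + 2 := by positivity
  rw [div_lt_iff₀ h1t, tn, lt_sub_comm]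
  push_cast
  rw [show (n : ℝ) + 1 + 1 = n + 2 by ring, div_lt_iff₀ hn]
  constructor <;> intro h <;> nlinarith

/-- Membership in the `n`-th block in terms of `1/(1-t)`. [folklore] -/
theorem mem_Ico_tn_iff {t : ℝ} (ht : t < 1) (n : ℕ) :
    t ∈ Ico (tn n) (tn (n + 1)) ↔ (n : ℝ) + 1 ≤ 1 / (1 - t) ∧ 1 / (1 - t) < n + 2 := by
  rw [mem_Ico, tn_le_iff ht, lt_tn_succ_iff ht]

/-- The block index of a point of the `n`-th block is `n`. [folklore] -/
theorem blockIdx_of_mem_Ico {t : ℝ} {n : ℕ} (h : t ∈ Ico (tn n) (tn (n + 1))) : blockIdx t = n := by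
  have ht : t < 1 := h.2.trans_le (tn_lt_one (n + 1)).le
  obtain ⟨h1, h2⟩ := (mem_Ico_tn_iff ht n).1 h
  unfold blockIdx
  have hfl : Nat.floor (1 / (1 - t)) = n + 1 := by
    rw [Nat.floor_eq_iff (by positivity)]
    push_cast
    exact ⟨h1, by linarith⟩
  rw [hfl]
  rfl

/-- Every `t ∈ [0,1)` lies in the block of its index. [folklore] -/
theorem mem_Ico_tn_blockIdx {t : ℝ} (h0 : 0 ≤ t) (ht : t < 1) :
    t ∈ Ico (tn (blockIdx t)) (tn (blockIdx t + 1)) := by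
  have h1t : 0 < 1 - t := by linarith
  have hge : (1 : ℝ) ≤ 1 / (1 - t) := by rw [le_div_iff₀ h1t]; linarith
  have hfl := Nat.floor_le (by positivity : (0 : ℝ) ≤ 1 / (1 - t))
  have hfl' := Nat.lt_floor_add_one (1 / (1 - t))
  have hpos : 1 ≤ Nat.floor (1 / (1 - t)) := by
    rw [Nat.one_le_floor_iff]; exact hge
  rw [mem_Ico_tn_iff ht]
  unfold blockIdx
  have hcast : ((Nat.floor (1 / (1 - t)) - 1 : ℕ) : ℝ) = (Nat.floor (1 / (1 - t)) : ℝ) - 1 := by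
    rw [Nat.cast_sub hpos, Nat.cast_one]
  rw [hcast]
  constructor <;> linarith

/-- Every `t ∈ [0,1)` lies in a unique block. [folklore] -/
theorem exists_mem_Ico_tn {t : ℝ} (h0 : 0 ≤ t) (ht : t < 1) : ∃ n, t ∈ Ico (tn n) (tn (n + 1)) :=
  ⟨blockIdx t, mem_Ico_tn_blockIdx h0 ht⟩

/-- The block index is monotone: `tₙ ≤ t < 1 ⇒ n ≤ blockIdx t`. [folklore] -/
theorem le_blockIdx_of_tn_le {t : ℝ} {n : ℕ} (h : tn n ≤ t) (ht : t < 1) : n ≤ blockIdx t := by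
  have h0 : 0 ≤ t := (tn_nonneg n).trans h
  have hmem := mem_Ico_tn_blockIdx h0 ht
  by_contra hlt
  push Not at hlt
  have : tn (blockIdx t + 1) ≤ tn n := tn_mono (Nat.succ_le_of_lt hlt)
  linarith [hmem.2]

/-- The block index tends to infinity as `t → 1⁻`. [folklore] -/
theorem tendsto_blockIdx : Tendsto blockIdx (𝓝[<] 1) atTop := by
  rw [tendsto_atTop]
  intro n
  have hmem : Ico (tn n) 1 ∈ 𝓝[<] (1 : ℝ) := Ico_mem_nhdsLT (tn_lt_one n)
  filter_upwards [hmem] with t ht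
  exact le_blockIdx_of_tn_le ht.1 ht.2

/-! ## The block reparametrisations `σₙ(t) = step ((t - tₙ)/τₙ)` -/

/-- The reparametrisation of the `n`-th block: `σₙ = 0` on `[tₙ, tₙ + τₙ/3]`, `σₙ = 1` on
`[tₙ + 2τₙ/3, tₙ₊₁]`, smooth and nondecreasing in between. [folklore] -/
def sigma (n : ℕ) (t : ℝ) : ℝ := step ((t - tn n) / tau n)

/-- The block reparametrisations are smooth. [folklore] -/
theorem sigma_contDiff (n : ℕ) {m : ℕ∞} : ContDiff ℝ m (sigma n) :=
  step_contDiff.comp ((contDiff_id.sub contDiff_const).div_const _)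

/-- The block reparametrisations take values in `[0,1]`. [folklore] -/
theorem sigma_mem_Icc (n : ℕ) (t : ℝ) : sigma n t ∈ Icc (0 : ℝ) 1 := step_mem_Icc _

/-- `σₙ = 0` on `(-∞, tₙ + τₙ/3]`. [folklore] -/
theorem sigma_of_le {n : ℕ} {t : ℝ} (ht : t ≤ tn n + tau n / 3) : sigma n t = 0 := by
  refine step_of_le ?_
  rw [div_le_iff₀ (tau_pos n)]
  linarith

/-- `σₙ = 1` on `[tₙ + 2τₙ/3, ∞)`. [folklore] -/
theorem sigma_of_ge {n : ℕ} {t : ℝ} (ht : tn n + 2 * tau n / 3 ≤ t) : sigma n t = 1 := by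
  refine step_of_ge ?_
  rw [le_div_iff₀ (tau_pos n)]
  linarith

/-- `σₙ(tₙ) = 0`. [folklore] -/
theorem sigma_tn (n : ℕ) : sigma n (tn n) = 0 := sigma_of_le (by linarith [tau_pos n])

/-- The derivative of `σₙ` (chain rule). [folklore] -/
theorem hasDerivAt_sigma (n : ℕ) (t : ℝ) :
    HasDerivAt (sigma n) (deriv step ((t - tn n) / tau n) / tau n) t := by
  have h1 : HasDerivAt (fun s => (s - tn n) / tau n) (1 / tau n) t := by
    simpa using ((hasDerivAt_id t).sub_const (tn n)).div_const (tau n)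
  have h2 : HasDerivAt step (deriv step ((t - tn n) / tau n)) ((t - tn n) / tau n) :=
    ((step_contDiff (n := 1)).differentiable (by simp)).differentiableAt.hasDerivAt
  have h3 := h2.comp t h1
  have h4 : HasDerivAt (sigma n) (deriv step ((t - tn n) / tau n) * (1 / tau n)) t := h3
  refine h4.congr_deriv ?_
  ring

/-- `σₙ'(t) = step'((t - tₙ)/τₙ)/τₙ`. [folklore] -/
theorem deriv_sigma (n : ℕ) (t : ℝ) : deriv (sigma n) t = deriv step ((t - tn n) / tau n) / tau n :=
  (hasDerivAt_sigma n t).deriv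

/-- `σₙ' = 0` strictly left of `tₙ + τₙ/3` and strictly right of `tₙ + 2τₙ/3`. [folklore] -/
theorem deriv_sigma_of_lt {n : ℕ} {t : ℝ} (ht : t < tn n + tau n / 3) : deriv (sigma n) t = 0 := by
  rw [deriv_sigma, deriv_step_of_lt, zero_div]
  rw [div_lt_iff₀ (tau_pos n)]; linarith

/-- `σₙ' = 0` strictly right of `tₙ + 2τₙ/3`. [folklore] -/
theorem deriv_sigma_of_gt {n : ℕ} {t : ℝ} (ht : tn n + 2 * tau n / 3 < t) : deriv (sigma n) t = 0 := by
  rw [deriv_sigma, deriv_step_of_gt, zero_div]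
  rw [lt_div_iff₀ (tau_pos n)]; linarith

/-- `σₙ'` is smooth. [folklore] -/
theorem deriv_sigma_contDiff (n : ℕ) {m : ℕ∞} : ContDiff ℝ m (deriv (sigma n)) := by
  have : deriv (sigma n) = fun t => deriv step ((t - tn n) / tau n) / tau n := funext (deriv_sigma n)
  rw [this]
  refine ContDiff.div_const ?_ _
  exact (step_contDiff.deriv' (n := m)).comp ((contDiff_id.sub contDiff_const).div_const _)

/-- The second derivative of `σₙ` (chain rule twice). [folklore] -/
theorem hasDerivAt_deriv_sigma (n : ℕ) (t : ℝ) :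
    HasDerivAt (deriv (sigma n)) (iteratedDeriv 2 step ((t - tn n) / tau n) / tau n ^ 2) t := by
  have hfun : deriv (sigma n) = fun t => deriv step ((t - tn n) / tau n) / tau n := funext (deriv_sigma n)
  rw [hfun]
  have h1 : HasDerivAt (fun s => (s - tn n) / tau n) (1 / tau n) t := by
    simpa using ((hasDerivAt_id t).sub_const (tn n)).div_const (tau n)
  have hd : Differentiable ℝ (deriv step) :=
    (step_contDiff.deriv' (n := (⊤ : ℕ∞))).differentiable (by simp)
  have h2 : HasDerivAt (deriv step) (iteratedDeriv 2 step ((t - tn n) / tau n)) ((t - tn n) / tau n) := by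
    have := (hd.differentiableAt (x := (t - tn n) / tau n)).hasDerivAt
    rwa [iteratedDeriv_succ, iteratedDeriv_one]
  have h3 := (h2.comp t h1).div_const (tau n)
  have h4 : HasDerivAt (fun s => deriv step ((s - tn n) / tau n) / tau n)
      (iteratedDeriv 2 step ((t - tn n) / tau n) * (1 / tau n) / tau n) t := h3
  refine h4.congr_deriv ?_
  field_simp

/-- Uniform bounds: `|σₙ'| ≤ B₁/τₙ`, `|σₙ''| ≤ B₂/τₙ²`. [folklore] -/
theorem exists_forall_abs_deriv_sigma_le : ∃ B : ℝ, 0 ≤ B ∧ ∀ n t, |deriv (sigma n) t| ≤ B / tau n := by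
  obtain ⟨B, hB⟩ := exists_forall_abs_iteratedDeriv_step_le 1
  refine ⟨max B 0, le_max_right _ _, fun n t => ?_⟩
  rw [deriv_sigma, abs_div, abs_of_pos (tau_pos n)]
  gcongr
  · exact (tau_pos n).le
  · simpa only [iteratedDeriv_one] using (hB _).trans (le_max_left _ _)

/-- Uniform bound `|σₙ''| ≤ B/τₙ²`. [folklore] -/
theorem exists_forall_abs_deriv_deriv_sigma_le :
    ∃ B : ℝ, 0 ≤ B ∧ ∀ n t, |deriv (deriv (sigma n)) t| ≤ B / tau n ^ 2 := by
  obtain ⟨B, hB⟩ := exists_forall_abs_iteratedDeriv_step_le 2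
  refine ⟨max B 0, le_max_right _ _, fun n t => ?_⟩
  rw [(hasDerivAt_deriv_sigma n t).deriv, abs_div, abs_of_pos (pow_pos (tau_pos n) 2)]
  gcongr
  exact (hB _).trans (le_max_left _ _)

end Literature.Analysis.FluidPDE.Gluing

end
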